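import Summits.Ventures.Crystal3D.Theorems.StickyWulffConstantLayerChainDefs
import HarnessLib

/-!
# Rung R4 of line `LayerChain` v4 (crux `StackingLiminf`, stmt-Ventures-19145): the two-phase pairing
# identity (Kirchhoff telescoping)

Cell `crystal3d-full`, venture `Summits/Ventures/Crystal3D`.  Planner rung `rung_pairing_identity`
(`HOME/cf-p1/route/lines/LayerChainV4Rungs.lean`, R4 [S/M], the algebraic heart of the TWO-PHASE PAIRING
of stub (B) `MollifiedUpper`), VERBATIM signature over the landed vocabulary `dot3`, `bPlus`, `bMinus`
(`…LayerChainDefs.lean`, p473239):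

gaps `k < m` between layers `k` and `k+1` carry letters `s k`; `grad k` stands for `∇v_k(y)`, `val k` for
`v_k(y)`; a `+` gap is paired with the field `βp` against the bond vectors `bPlus i`, a `−` gap with `βm`
against `bMinus i`.  Under the Kirchhoff condition `Σ βp = Σ βm` (the certificate of
`mem_stackWulff_of_certificate`) the gap-by-gap pairing regroups into the two PHASE sums
`Σ_{s k = 1} grad k`, `Σ_{s k ≠ 1} grad k`, and the layer differences `val k − val (k+1)` telescope to
`(Σ βp)·(val 0 − val m)` — they vanish for a configuration padded by empty layers.
WHAT THIS IS NOT: any analysis; pure `Finset` algebra.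
-/

noncomputable section

namespace Summit.Ventures.Crystal3D.Theorems

open Finset
open Summit.Ventures.Crystal3D.LayerChain (dot3 bPlus bMinus)

/-- `dot3` is additive in its first argument over finite sums. -/
theorem dot3_sum_left {ι : Type*} (S : Finset ι) (g : ι → Fin 3 → ℝ) (v : Fin 3 → ℝ) :
    dot3 (∑ k ∈ S, g k) v = ∑ k ∈ S, dot3 (g k) v := by
  unfold dot3
  simp only [Finset.sum_apply, Finset.sum_mul, ← Finset.sum_add_distrib]

/-- **R4 — the two-phase pairing identity.** -/
theorem rung_pairing_identity (m : ℕ) (s : ℕ → ℤ) (grad : ℕ → (Fin 3 → ℝ)) (val : ℕ → ℝ)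
    (βp βm : Fin 3 → ℝ) (hK : ∑ i, βp i = ∑ i, βm i) :
    ∑ k ∈ Finset.range m, ∑ i : Fin 3,
        (if s k = 1 then βp i else βm i) *
          (-(dot3 (grad k) (if s k = 1 then bPlus i else bMinus i)) + (val k - val (k + 1)))
      = (∑ i : Fin 3, βp i *
            -(dot3 (∑ k ∈ (Finset.range m).filter (fun k => s k = 1), grad k) (bPlus i)))
        + (∑ i : Fin 3, βm i *
            -(dot3 (∑ k ∈ (Finset.range m).filter (fun k => s k ≠ 1), grad k) (bMinus i)))
        + (∑ i, βp i) * (val 0 - val m) := by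
  -- split each gap term into its gradient part and its layer-difference part
  have hgap : ∀ k, ∑ i : Fin 3, (if s k = 1 then βp i else βm i) *
        (-(dot3 (grad k) (if s k = 1 then bPlus i else bMinus i)) + (val k - val (k + 1))) =
      (∑ i : Fin 3, (if s k = 1 then βp i else βm i) *
          -(dot3 (grad k) (if s k = 1 then bPlus i else bMinus i))) +
        (∑ i : Fin 3, βp i) * (val k - val (k + 1)) := by
    intro k
    rw [← sum_add_distrib.symm.trans (sum_congr rfl fun i _ => (mul_add _ _ _).symm), sum_mul]
    congr 1
    by_cases hk : s k = 1
    · simp [hk]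
    · simp only [hk, if_false]
      rw [← sum_mul, ← sum_mul, ← hK]
  simp_rw [hgap]
  rw [sum_add_distrib, ← mul_sum, Finset.sum_range_sub' val m]
  congr 1
  -- the gradient part: split the gaps by phase
  rw [← sum_filter_add_sum_filter_not (range m) (fun k => s k = 1)]
  congr 1
  · simp only [dot3_sum_left, ← sum_neg_distrib, mul_sum]
    rw [sum_comm]
    refine sum_congr rfl fun i _ => sum_congr rfl fun k hk => ?_
    have hk1 : s k = 1 := (mem_filter.1 hk).2
    simp only [hk1, if_true]
  · simp only [dot3_sum_left, ← sum_neg_distrib, mul_sum]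
    rw [sum_comm]
    refine sum_congr rfl fun i _ => sum_congr rfl fun k hk => ?_
    have hk1 : ¬ s k = 1 := (mem_filter.1 hk).2
    simp only [hk1, if_false]

end Summit.Ventures.Crystal3D.Theorems

end
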